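import Literature.NumberTheory.Automorphic.Liu2021.Sec13to16IntroductionAFL
import Mathlib.RingTheory.Length
import Mathlib.RingTheory.UniqueFactorizationDomain.NormalizedFactors
import Mathlib.RingTheory.Polynomial.UniqueFactorization
import Mathlib.Algebra.Polynomial.Reverse
import Mathlib.Algebra.Ring.NegOnePow
import Mathlib.Data.Set.Card
import HarnessLib

/-!
# Liu 2021, Appendix A «Proof of the arithmetic fundamental lemma in the minuscule case» (by Chao Li and Yihang Zhu),
# print pp. 90–95: the statements A.1–A.6 AS PRINTED over ★ `Sec13Data` — carpet (statements only)

Source: Y. Liu, *Fourier–Jacobi cycles and arithmetic relative trace formula (with an appendix by C. Li and Y. Zhu)*,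
Camb. J. Math. **9** (2021), no. 1, 1–147 [Liu2021]; print pages from the held journal text
(`paper:liu2021-fourier-jacobi-cycles-arithmetic-relative-trace-formula`, page file = journal page); second locator =
TeX of record `FJcycle.tex` (md5 6db49a74…), App. A = `\label{ss:e}`, l. 4015–4215 (§A.1 l. 4025–4140, §A.2
l. 4143–4215).  Appendix A «follow[s] the setup and notation in Subsection 1.3», which the tree types in
★ `Literature/NumberTheory/Automorphic/Liu2021/Sec13to16IntroductionAFL.lean` (`Sec13Data`: the fields `F ⊆ E` with the
Galois involution `c`, `n`, `q`, the valuation `ordE`, `S_n(F)` = ★ `Sec13Data.Sn`, `M_n(F)` = ★ `Sec13Data.Mn`, regular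
semisimplicity ★ `IsRS` ∕ ★ `IsRSU`, the `−` orbits ★ `IsMinus`, matching ★ `Matches`, the orbital integral ★ `orb` with
`𝟙_{S_n(O_F)}` = ★ `oneS`, `𝟙_{M_n(O_F)}` = ★ `oneM`, the hermitian space `V_n^− = V false` with `( , )` = ★ `herm false` and
`U(V_n^−)(F) = U false` acting through ★ `toEnd`, the intersection number `χ(𝒪_{Γ_ξ} ⊗^𝕃 𝒪_{Δ𝒵_n(x)})` = ★ `chiInt`, «minuscule» =
★ `IsMinuscule`, and item 1.12 in the minuscule case = ★ `Sec13Data.Rem114`).  THIS FILE EXTENDS that datum (`AFLData extends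
Sec13Data`) by the objects App. A adds and types A.1–A.6 on it; nothing of §1.3 is re-declared.

STATEMENT-ONLY CARPET (squad TL «Liu FJ∕418», seat TL-t14; TYPER LINT RULE): named notions with bodies and named
statements `def … : Prop`, each with a cite docstring; no proofs, no `instance`, no `notation`.  REAL where Mathlib has the
object (the ring `𝒪_E ⊆ E`, `𝒪_E`-submodules and ★ `Module.length`, the lattices `L₁`, `L₂`, `L`, their duals as sets,
`M_i`, `N_i` and their cardinalities ★ `Set.ncard`, the residue-field combinatorics of §A.2 over ★ `normalizedFactors` ∕
★ `Polynomial.reverse`); ⟨CARRIER⟩ (posited, meanings VERBATIM, nothing asserted): the involution `τ` (p. 92), the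
characteristic polynomial `P(T)` of `ξ̄` on `L*/L` (p. 93), and the `k`-schemes `Γ_ξ ∩ Δ𝒵_n(x)`, `𝒱(Λ)^{ξ̄}` of Lem. A.5–A.6
(relative Rapoport–Zink spaces and Deligne–Lusztig varieties have no Mathlib∕tree currency).  NOTHING IS ASSERTED: every
printed statement is a predicate `def … (D : AFLData …) : Prop` (the objects live on `AFLCarriers extends Sec13Data`, the datum
`AFLData extends AFLCarriers` adds the three defining sentences as fields) = a VERBATIM reading with locator (class **P**); a consumer
supplies the datum and takes `(h : D.LemA6)` etc. as explicit hypotheses — never `∀ D, …`.  Class **D** = a definition read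
off the print (REAL body).  The printed DEFINING SENTENCES of the three posited identifications (`τ`; «minuscule» for the ★ carrier `IsMinuscule`; App. A's
`ω := (−1)^v` versus §1.3's ★ `transferFactor`) are propositional FIELDS `tau_spec` ∕ `isMinuscule_iff` ∕ `transferFactor_eq` of
`AFLData` (squad rule L5: hypotheses every consumer sees, not named facts); the standing meaning of the ★ `Sec13Data` carriers
(`V false` IS `V_n^−`, `conjκ` IS the involution of `κ_E` induced by `c`) is, as in the §1.3 carpet, not a hypothesis of the facts.  STANDING NOTATION (p. 90 L14–18) is ONE bundled hypothesis `NotationAsAbove` prefixed to every item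
(squad rule L2b); READING O1 of the §1.3 carpet (orbits ↦ pairs, «the unique orbit that matches» ↦ «every matching regular
semisimple pair») is kept.

## INDEX (print numbering = TeX counter; p. = journal page of the item's first line)

| item | content | Lean |
|---|---|---|
| §A.1 opening (p. 90 L14–18; l. 4028–4031) | standing notation: `(ζ, y) ∈ [S_n(F) × M_n(F)]^-_rs`, `(ξ, x) ∈ [U(V_n^-)(F) × V_n^-(E)]_rs` matching it, (A.1) | D: `NotationAsAbove` (over ★ `Sn`, ★ `IsRS`, ★ `IsMinus`, ★ `IsRSU`, ★ `Matches`) |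
| §A.1 set-up (p. 90 L19–31; l. 4032–4047) | `v(ζ,y)`, `ω(ζ,y) := (−1)^{v(ζ,y)}`, `Δ(ζ,y)`, `δ(ζ,y)`, `L₁`, `L₂`, `M_i(ζ,y)`, pairing (A.2), `Λ^∨` | D: `vVal`, `omega`, `Delta`, `deltaVal`, `latL₁`, `latL₂`, `sesq`, `dualVee`, `IsOELattice`, `latticeSetM`; field `AFLData.transferFactor_eq` (`ω` of §1.3 = ★ `transferFactor` vs `(−1)^v`) |
| **Lem. A.1** (p. 91 L3; l. 4050–4055) | `d/ds|₀ Orb = −2 log q · ω · Σ_{i≥0} (−1)^i (v − i) · #M_i` | P: `LemA1` |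
| p. 92 L9–20 (l. 4098–4106) | `φ₁`, `φ₂`, the involution `τ` | field `tau` + field `AFLData.tau_spec` (`φ₁`, `φ₂` INDEX only: used only inside proofs) |
| p. 92 L21–27 (l. 4108–4115) | `L = L_{ξ,x}`, `L*`, `N_i(ζ,y)` | D: `latL`, `dualStar`, `latticeSetN`, `altSumN` |
| **Prop. A.2** (p. 92 L28; l. 4118–4124) | `d/ds|₀ Orb = −2 log q · ω · Σ_{i=0}^{δ} (−1)^i (−i) · #N_i` | P: `PropA2` |
| Rem. A.3 (p. 93 L16; l. 4138–4140) | «sign error in [RTZ13, Cor. 7.3 (2)], corrected in Prop. A.2» | INDEX only (no mathematical statement) |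
| §A.2 set-up (p. 93 L19 – p. 94 L4; l. 4145–4159) | minuscule `ϖL* ⊆ L ⊆ L*`; `κ_E`, `ξ̄ ∈ U(L*/L)`, `P(T)`, `R*(T)`, self-reciprocal, `m(R)`, `NSR` | field `AFLData.isMinuscule_iff` (pins ★ `IsMinuscule`); fields `unif`, `conjκ`, `redCharpoly`; D: `reciprocalPoly`, `IsSelfReciprocal`, `factorMult`, `oddSelfRecFactors`, `nsrOrbits`, `lzCount` |
| **Lem. A.4** (p. 94 L5; l. 4161–4170) | the alternating sum `= deg Q · (m(Q)+1)/2 · ∏_{NSR} (1 + m(R))`, else `0` | P: `LemA4` |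
| p. 94 L17–21 (l. 4177) | `Λ := L*` is a vertex lattice `ϖΛ ⊆ Λ* ⊆ Λ`; `𝒱(Λ)` [LZ17, §2.5], [RTZ13, §3] | D: `IsVertexLattice` (the one-line remark «Λ is a vertex lattice» is NOT a named fact: it follows from the definitions); field `dlFixed` |
| **Lem. A.5** (p. 94 L22; l. 4179–4185) | `Γ_ξ ∩ Δ𝒵_n(x) ≅ 𝒱(Λ)^{ξ̄}` | P: `LemA5` (fields `interGammaDeltaZ`, `IsoK`) |
| **Lem. A.6** (p. 95 L1; l. 4196–4201) | emptiness criterion; Artinian; `χ(…) = length_k 𝒱(Λ)^{ξ̄} =` the count | P: `LemA6` (fields `IsEmptyK`, `IsArtinianK`, `lengthK`; `χ` = ★ `chiInt`) |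
| **Thm. A.7** (p. 95 L12; l. 4208–4210) | «1.12 holds when `(ξ, x)` is minuscule» | ★ `Sec13Data.Rem114` (typed with Rem. 1.14 by the §1.3 carpet — CITED, not restated) |
| proofs (pp. 91–95) | lattice-counting bijection `g ↦ g·Mat_{n,1}(𝒪_E)`; [RTZ13, Prop. 8.1∕8.2], [LZ17, Cor. 3.2.3, §2.5–2.6], [HLZ19, Lem. 5.1.1, Thm. 4.6.3], [Cho] | NOT typed |

DEDUP (2026-09-02): `rg 'cite: Liu2021, … A.[1-6]'` over `Literature` + `Summits` = 0 files (Thm. A.7 ∕ Rem. 1.14 ∕ §1.3 live in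
★ `Sec13to16IntroductionAFL.lean`, imported); `lean search` self-reciprocal ∕ vertex lattice ∕ lattice counting = no relevant decl
(the tree's `Algebra/Polynomial/SelfReciprocal*` concern real palindromic polynomials, not the `c`-twisted reciprocal over `𝔽_{q²}`).

HC_CM is proved only modulo the 7 printed citations (2 remaining: hLiu418, h413) until rung 0 closes; nothing asserted here.

## References
* [Liu2021] Y. Liu, Camb. J. Math. 9 (2021) 1–147: App. A pp. 90–95 (TeX l. 4015–4215); §1.3 pp. 11–15 (l. 848–961).
* [RTZ13] M. Rapoport, U. Terstiege, W. Zhang, *On the arithmetic fundamental lemma in the minuscule case*, Compos. Math.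
  149 (2013) 1631–1666, Prop. 8.1, 8.2, Cor. 7.3; [LZ17] C. Li, Y. Zhu, *Remarks on the arithmetic fundamental lemma*,
  Algebra Number Theory 11 (2017), §2.5–2.6, Cor. 3.2.3 (held: `paper:arxiv-1705.05167`, p. 3: same «unique self-reciprocal
  monic irreducible factor `Q(T)|P(T)` such that `m(Q(T))` is odd», `c := (m(Q(T))+1)/2`); [HLZ19] X. He, C. Li, Y. Zhu,
  Forum Math. Sigma 7 (2019), Lem. 5.1.1, Thm. 4.6.3 — cited in print as the sources of the proofs; not typed.
-/

noncomputable section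

open Polynomial UniqueFactorizationMonoid Matrix
open Literature.NumberTheory.Automorphic.Liu2021.Sec13to16IntroductionAFL

namespace Literature.NumberTheory.Automorphic.Liu2021.AppendixA.AFLMinusculeCase

universe u

/-! ## §0. The residue-field combinatorics of §A.2 (REAL): reciprocal polynomials, `m(R)`, `NSR`, the Li–Zhu count -/

section Reciprocal

variable {κ : Type u} [Field κ] [DecidableEq κ]

/-- D. **Reciprocal polynomial** (§A.2, p. 93 L30–36): «for a polynomial `R(T) = a_k T^k + ⋯ + a_1 T + a_0 ∈ κ_E[T]` with
`a_0 a_k ≠ 0`, we define its reciprocal polynomial as `R*(T) := (a_0^c)^{-1} · T^k · R(1/T)^c`», `c` the involution of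
`κ_E ≅ 𝔽_{q²}` induced by the Galois involution of `E/F` (here an arbitrary ring endomorphism `c` of a field `κ`).  REAL:
`T^k · R(1/T)` = ★ `Polynomial.reverse` (for `a_0 ≠ 0`), `(·)^c` on coefficients = ★ `Polynomial.map c`; junk when `a_0 = 0`.
[cite: Liu2021, App. A §A.2 (p. 93 L30–36); FJcycle.tex l. 4149–4157] -/
def reciprocalPoly (c : κ →+* κ) (R : κ[X]) : κ[X] :=
  C (c (R.coeff 0))⁻¹ * (R.reverse.map c)

/-- D. **Self-reciprocal** (§A.2, p. 93 L36): «we say that `R(T)` is self-reciprocal if `R(T) = R*(T)`».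
[cite: Liu2021, App. A §A.2 (p. 93 L36); FJcycle.tex l. 4157] -/
def IsSelfReciprocal (c : κ →+* κ) (R : κ[X]) : Prop :=
  reciprocalPoly c R = R

/-- D. **Multiplicity `m(R(T))`** (§A.2, p. 93 L38–39): «for every irreducible factor `R(T)` of `P(T)` … we denote the
multiplicity of `R(T)` in `P(T)` by `m(R(T))`».  REAL: the number of occurrences of the monic irreducible `R` in the multiset
★ `normalizedFactors P` of monic irreducible factors of `P` (`0` if `R` is not such a factor).
[cite: Liu2021, App. A §A.2 (p. 93 L38–39); FJcycle.tex l. 4159] -/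
def factorMult (P R : κ[X]) : ℕ :=
  (normalizedFactors P).count R

/-- D. The set of **self-reciprocal monic irreducible factors `Q(T)` of `P(T)` with `m(Q(T))` odd** — the objects the
hypothesis of Lem. A.4 ∕ Lem. A.6 quantifies («`P(T)` has a unique self-reciprocal monic irreducible factor `Q(T)` such that
`m(Q(T))` is odd» is read: this set is a singleton `{Q}` — the reading of [RTZ13, Prop. 8.2] ∕ [LZ17, p. 3], where
`c = (m(Q(T))+1)/2` is the length); the monic irreducible factors of `P` = the support of ★ `normalizedFactors P` (REAL).
[cite: Liu2021, Lem. A.4 (p. 94 L5–6); FJcycle.tex l. 4161–4162] -/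
def oddSelfRecFactors (c : κ →+* κ) (P : κ[X]) : Finset κ[X] :=
  @Finset.filter _ (fun Q => IsSelfReciprocal c Q ∧ Odd (factorMult P Q)) (Classical.decPred _)
    (normalizedFactors P).toFinset

/-- D. **`NSR`** (§A.2, p. 94 L1–4): «taking reciprocal `R(T) ↦ R*(T)` induces an involution on the set of irreducible factors
of `P(T)`.  We denote by `NSR` the set of all orbits of non-self-reciprocal monic irreducible factors of `P(T)` under this
involution» — REAL: the finset of the pairs `{R, R*}`, `R` a non-self-reciprocal monic irreducible factor of `P`.
[cite: Liu2021, App. A §A.2 (p. 94 L1–4); FJcycle.tex l. 4159] -/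
def nsrOrbits (c : κ →+* κ) (P : κ[X]) : Finset (Finset κ[X]) :=
  (@Finset.filter _ (fun R => ¬ IsSelfReciprocal c R) (Classical.decPred _) (normalizedFactors P).toFinset).image
    fun R => {R, reciprocalPoly c R}

/-- D. **The Li–Zhu count** (right-hand side of Lem. A.4 and Lem. A.6, p. 94 L8–9 ∕ p. 95 L6–7):
`deg Q(T) · (m(Q(T)) + 1)/2 · ∏_{{R(T), R*(T)} ∈ NSR} (1 + m(R(T)))`, for a self-reciprocal factor `Q` of `P` with `m(Q)` odd
(so `(m(Q)+1)/2 ∈ ℕ`; natural-number division is exact there).  The multiplicity of an orbit `{R, R*}` is read as `m(R)`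
(`= m(R*)` for `P` self-reciprocal, p. 93 L40 – p. 94 L1; REAL: the `sup` over the orbit).
[cite: Liu2021, Lem. A.4 (p. 94 L8–9); FJcycle.tex l. 4163–4165] -/
def lzCount (c : κ →+* κ) (P Q : κ[X]) : ℕ :=
  Q.natDegree * ((factorMult P Q + 1) / 2) * ∏ o ∈ nsrOrbits c P, (1 + o.sup (factorMult P))

end Reciprocal

/-! ## §1. The datum: ★ `Sec13Data` extended by the objects App. A adds -/

/-- **Standing data of App. A, I: the objects** (p. 90 – p. 95) over the §1.3 datum ★ `Sec13Data F E` (which it EXTENDS: `F ⊆ E`, `c = conj`, `n`,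
`q`, the valuation `ordE`, `S_n`, `M_n`, `Orb`, `V_n^± = V δ`, `herm`, `U`, `toEnd`, `chiInt`, `IsMinuscule` — see that file), with
the residue field `κ = κ_E ≅ 𝔽_{q²}` of `E` (p. 93 L22) as a type parameter.  REAL new fields: `OE = 𝒪_E ⊆ E` (p. 90 L24: «two
`𝒪_E`-lattices»), a uniformizer `unif = ϖ` of `F` (p. 93 L19: «Choose a uniformizer `ϖ` of `F`»), the involution `conjκ` of `κ_E`
induced by `c` (p. 93 L33: `a_0^c`, `R(1/T)^c`).  ⟨CARRIER⟩ new fields (posited primitives, meanings VERBATIM, nothing asserted):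
`tau ξ x = τ` «the unique `F`-linear involution `τ : V_n^−(E) → V_n^−(E)` satisfying `τ(a · ξ^i x) = a^c · ξ^{−i} x`» (p. 92 L17–20);
`redCharpoly ξ x = P(T) ∈ κ_E[T]` «the characteristic polynomial of `ξ̄` on `L*/L`» (p. 93 L25–27; `ξ̄ ∈ U(L*/L)` the action induced
on the `κ_E`-vector space `L*/L`); the `k`-schemes (`k` the residue field of `Ĕ`, p. 11 L38) `interGammaDeltaZ ξ x = Γ_ξ ∩ Δ𝒵_n(x)`
(`Γ_ξ ⊆ 𝒩_n²` the graph of `ξ`, p. 14 L22–24; `𝒵_n(x)` = Def. 1.11 = ★ `specialDivisor`) and `dlFixed ξ x = 𝒱(Λ)^{ξ̄}`, `Λ = L*_{ξ,x}`,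
«`𝒱(Λ)` the Deligne–Lusztig variety associated to the vertex lattice `Λ` as in [LZ17, Section 2.5] and [RTZ13, Section 3], which
is a smooth projective variety over `k`» (p. 94 L17–21), with the relations `IsoK` («canonical isomorphism of `k`-schemes»,
p. 94 L22), `IsEmptyK` («is empty», p. 95 L1), `IsArtinianK` («is an Artinian `k`-scheme», p. 95 L3) and `lengthK = length_k`
(p. 95 L5).  Nothing is asserted by this structure; the printed DEFINING SENTENCES of the posited `tau`, of «minuscule» and of
App. A's transfer factor are the propositional fields of `AFLData` below (hypotheses a consumer sees; squad rule L5).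
[cite: Liu2021, App. A (pp. 90–95); FJcycle.tex l. 4028–4047, 4098–4115, 4145–4177] -/
structure AFLCarriers (F E : Type u) [Field F] [Field E] [Algebra F E] (κ : Type u) [Field κ] : Type (u + 1)
    extends Sec13Data F E where
  /-- the ring of integers `𝒪_E ⊆ E` (p. 90 L24) -/
  OE : Subring E
  /-- a uniformizer `ϖ` of `F` (p. 93 L19) -/
  unif : F
  /-- the involution of `κ_E ≅ 𝔽_{q²}` induced by `c` (p. 93 L33) -/
  conjκ : κ →+* κ
  /-- ⟨CARRIER⟩ the `F`-linear involution `τ = τ_{ξ,x}` of `V_n^−(E)`, `τ(a · ξ^i x) = a^c · ξ^{−i} x` (p. 92 L17–20; TeX l. 4106) -/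
  tau : U false → V false → V false → V false
  /-- ⟨CARRIER⟩ `P(T) ∈ κ_E[T]`, «the characteristic polynomial of `ξ̄` on `L*/L`» (p. 93 L25–27; TeX l. 4148–4149) -/
  redCharpoly : U false → V false → κ[X]
  /-- ⟨CARRIER⟩ the type of (isomorphism classes of) `k`-schemes, `k` the residue field of `Ĕ` (p. 11 L38, p. 94 L20–21) -/
  KSch : Type u
  /-- ⟨CARRIER⟩ the `k`-scheme `Γ_ξ ∩ Δ𝒵_n(x)` (Lem. A.5, p. 94 L23) -/
  interGammaDeltaZ : U false → V false → KSch
  /-- ⟨CARRIER⟩ the `k`-scheme `𝒱(Λ)^{ξ̄}`, `Λ = L*_{ξ,x}` (Lem. A.5, p. 94 L17–23) -/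
  dlFixed : U false → V false → KSch
  /-- ⟨CARRIER⟩ «canonical isomorphism of `k`-schemes» (Lem. A.5, p. 94 L22–24) -/
  IsoK : KSch → KSch → Prop
  /-- ⟨CARRIER⟩ «is empty» (Lem. A.6, p. 95 L1) -/
  IsEmptyK : KSch → Prop
  /-- ⟨CARRIER⟩ «is an Artinian `k`-scheme» (Lem. A.6, p. 95 L3) -/
  IsArtinianK : KSch → Prop
  /-- ⟨CARRIER⟩ `length_k` of an Artinian `k`-scheme (Lem. A.6, p. 95 L5) -/
  lengthK : KSch → ℕ

namespace AFLCarriers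

variable {F E : Type u} [Field F] [Field E] [Algebra F E] {κ : Type u} [Field κ]
variable (D : AFLCarriers F E κ)

/-! ## §2. Standing notation of App. A and the §A.1 invariants `v`, `ω`, `Δ`, `δ` (class D, REAL over ★ `Sec13Data`) -/

/-- D. **Standing notation of App. A** (§A.1 opening, p. 90 L14–18): «We take a regular semisimple orbit `(ζ, y) ∈ [S_n(F) ×
M_n(F)]^-_rs`, where `y = (y₁, y₂) ∈ Mat_{n,1}(F) × Mat_{1,n}(F)`.  Let `(ξ, x) ∈ [U(V_n^-)(F) × V_n^-(E)]_rs` be the unique orbit that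
matches `(ζ, y)`.  By definition, `ζ` and `ξ` have the same characteristic polynomial; and we have (A.1) `y₂ ζ^i y₁ = (ξ^i x, x)`,
`i = 0, …, n − 1`.»  ONE bundled hypothesis prefixed to every item (READING O1 of the §1.3 carpet: pairs, every matching pair):
`ζ ∈ S_n(F)` (★ `Sn`), `(ζ, y)` regular semisimple (★ `IsRS`) in the `−` part (★ `IsMinus`), `(ξ, x)` regular semisimple on
`V_n^−` (★ `IsRSU false`), and the two match (★ `Matches`, = (A.1) + equal characteristic polynomials).
[cite: Liu2021, App. A §A.1 (p. 90 L14–18) and (A.1); FJcycle.tex l. 4028–4031] -/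
def NotationAsAbove (ζ : Matrix (Fin D.n) (Fin D.n) E) (y : D.Mn) (ξ : D.U false) (x : D.V false) : Prop :=
  ζ ∈ D.Sn ∧ D.IsRS ζ y ∧ D.IsMinus ζ y ∧ D.IsRSU false ξ x ∧ D.Matches ζ y false ξ x

/-- D. **`v(ζ, y) := val(det(y₁, ζy₁, …, ζ^{n-1}y₁))`** (p. 90 L19–20; the matrix with columns `ζ^j y₁`, `j = 0, …, n − 1`, the
argument of `μ_{E/F}` in ★ `Sec13Data.transferFactor`), `val` = ★ `ordE`. [cite: Liu2021, App. A §A.1 (p. 90 L19–20); FJcycle.tex l. 4032] -/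
def vVal (ζ : Matrix (Fin D.n) (Fin D.n) E) (y : D.Mn) : ℤ :=
  D.ordE (Matrix.of fun i k : Fin D.n => (ζ ^ k.1).mulVec (D.y₁E y) i).det

/-- D. **Transfer factor of App. A, `ω(ζ, y) := (−1)^{v(ζ,y)}`** (p. 90 L20–21: «Recall that we denote `v(ζ, y) := …`, and define
the transfer factor to be `ω(ζ, y) := (−1)^{v(ζ,y)}`»).  App. A's OWN definition, REAL over ★ `ordE` (★ `Int.negOnePow`); §1.3
(p. 12 L5–7) writes `ω(ζ, y) := μ_{E/F}(det(y₁, ζy₁, …, ζ^{n-1}y₁))` = ★ `Sec13Data.transferFactor` over the ⟨CARRIER⟩ `μ_{E/F}` —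
the same number for `E/F` unramified (`μ_{E/F} = (−1)^{val}`); the identification is the field `AFLData.transferFactor_eq` below.
[cite: Liu2021, App. A §A.1 (p. 90 L20–21); FJcycle.tex l. 4032] -/
def omega (ζ : Matrix (Fin D.n) (Fin D.n) E) (y : D.Mn) : ℤ :=
  ((D.vVal ζ y).negOnePow : ℤˣ)

/-- D. **`Δ(ζ, y) := det(y₂ ζ^{i+j-2} y₁)_{i,j=1}^n`** (p. 90 L21; `0`-indexed entries `y₂ ζ^{i+j} y₁`, the matrix of ★ `Sec13Data.IsRS`).
[cite: Liu2021, App. A §A.1 (p. 90 L21); FJcycle.tex l. 4032] -/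
def Delta (ζ : Matrix (Fin D.n) (Fin D.n) E) (y : D.Mn) : E :=
  (Matrix.of fun i j : Fin D.n => D.y₂E y ⬝ᵥ (ζ ^ (i.1 + j.1)).mulVec (D.y₁E y)).det

/-- D. **`δ(ζ, y) := val(Δ(ζ, y))`** (p. 90 L21–22; «As `(ζ, y) ∈ [S_n(F) × M_n(F)]^-_rs`, we know that `δ(ζ, y)` is odd» = ★ `IsMinus`).
[cite: Liu2021, App. A §A.1 (p. 90 L21–22); FJcycle.tex l. 4032] -/
def deltaVal (ζ : Matrix (Fin D.n) (Fin D.n) E) (y : D.Mn) : ℤ :=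
  D.ordE (D.Delta ζ y)

/-! ## §3. §A.1: the lattices `L₁`, `L₂`, the pairing (A.2), `M_i(ζ, y)` (class D, REAL) -/

/-- D. **`𝒪_E`-lattice** in a finite-dimensional `E`-vector space `M` (`Mat_{n,1}(E) = E^n`, p. 90 L23–27; `V_n^-(E)`, p. 92
L24): a finitely generated `𝒪_E`-submodule spanning `M` over `E` (cf. ★ `Submodule.IsLattice`, same two clauses).
[cite: Liu2021, App. A §A.1 (p. 90 L23–27, p. 92 L24); FJcycle.tex l. 4034–4041, 4114] -/
def IsOELattice {M : Type u} [AddCommGroup M] [Module E M] (Λ : Submodule D.OE M) : Prop :=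
  Λ.FG ∧ Submodule.span E (Λ : Set M) = ⊤

/-- D. **`L₁ = L_{ζ,y₁} := 𝒪_E y₁ ⊕ 𝒪_E ζy₁ ⊕ ⋯ ⊕ 𝒪_E ζ^{n-1}y₁ ⊆ Mat_{n,1}(E)`** (p. 90 L24), as the `𝒪_E`-span (column vectors,
`y₁` over `E` = ★ `y₁E`). [cite: Liu2021, App. A §A.1 (p. 90 L24); FJcycle.tex l. 4036–4037] -/
def latL₁ (ζ : Matrix (Fin D.n) (Fin D.n) E) (y : D.Mn) : Submodule D.OE (Fin D.n → E) :=
  Submodule.span D.OE (Set.range fun i : Fin D.n => (ζ ^ i.1).mulVec (D.y₁E y))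

/-- D. **`L₂ = L_{ζ,y₂} := 𝒪_E y₂ ⊕ 𝒪_E y₂ζ ⊕ ⋯ ⊕ 𝒪_E y₂ζ^{n-1} ⊆ Mat_{1,n}(E)`** (p. 90 L25), as the `𝒪_E`-span (row vectors,
`y₂` over `E` = ★ `y₂E`). [cite: Liu2021, App. A §A.1 (p. 90 L25); FJcycle.tex l. 4038–4039] -/
def latL₂ (ζ : Matrix (Fin D.n) (Fin D.n) E) (y : D.Mn) : Submodule D.OE (Fin D.n → E) :=
  Submodule.span D.OE (Set.range fun i : Fin D.n => Matrix.vecMul (D.y₂E y) (ζ ^ i.1))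

/-- D. **The standard sesquilinear form (A.2)** `Mat_{n,1}(E) × Mat_{1,n}(E) → E`, `(x₁, x₂) ↦ x₂^c · x₁` (p. 90 L30–31).
[cite: Liu2021, App. A (A.2) (p. 90 L30–31); FJcycle.tex l. 4044–4047] -/
def sesq (x₁ x₂ : Fin D.n → E) : E :=
  ∑ j, D.conj (x₂ j) * x₁ j

/-- D. **Dual lattice `Λ^∨ ⊆ Mat_{1,n}(E)`** of `Λ ⊆ Mat_{n,1}(E)` «under the standard sesquilinear form (A.2)» (p. 90 L29–31):
the row vectors pairing `Λ` into `𝒪_E` (as a set). [cite: Liu2021, App. A §A.1 (p. 90 L29–31); FJcycle.tex l. 4043–4047] -/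
def dualVee (Λ : Submodule D.OE (Fin D.n → E)) : Set (Fin D.n → E) :=
  {x₂ | ∀ x₁ ∈ Λ, D.sesq x₁ x₂ ∈ D.OE}

/-- D. **`M_i(ζ, y)`** (p. 90 L27–28): «`{𝒪_E-lattice Λ ⊆ Mat_{n,1}(E) | L₁ ⊆ Λ, L₂ ⊆ Λ^∨, Λ^c = Λ, ζΛ = Λ, length_{𝒪_E}(Λ/L₁) =
i}`», `Λ^c` the coordinatewise Galois conjugate, `length` = ★ `Module.length`.
[cite: Liu2021, App. A §A.1 (p. 90 L27–28); FJcycle.tex l. 4041] -/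
def latticeSetM (ζ : Matrix (Fin D.n) (Fin D.n) E) (y : D.Mn) (i : ℕ) : Set (Submodule D.OE (Fin D.n → E)) :=
  {Λ | D.IsOELattice Λ ∧ D.latL₁ ζ y ≤ Λ ∧ (D.latL₂ ζ y : Set (Fin D.n → E)) ⊆ D.dualVee Λ ∧
    (fun v : Fin D.n → E => fun j => D.conj (v j)) '' (Λ : Set (Fin D.n → E)) = Λ ∧
    (fun v : Fin D.n → E => ζ.mulVec v) '' (Λ : Set (Fin D.n → E)) = Λ ∧
    Module.length D.OE (Λ ⧸ (D.latL₁ ζ y).comap Λ.subtype) = i}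

/-! ## §4. §A.1 p. 92: `L = L_{ξ,x}`, `L*`, `N_i(ζ, y)` (class D) -/

/-- D. **`L = L_{ξ,x} := 𝒪_E x ⊕ 𝒪_E ξx ⊕ ⋯ ⊕ 𝒪_E ξ^{n-1}x ⊆ V_n^-(E)`** (p. 92 L22; Rem. 1.14, p. 15), as the `𝒪_E`-span, `ξ`
acting through ★ `toEnd false`. [cite: Liu2021, App. A §A.1 (p. 92 L21–22); FJcycle.tex l. 4108–4111] -/
def latL (ξ : D.U false) (x : D.V false) : Submodule D.OE (D.V false) :=
  Submodule.span D.OE (Set.range fun i : Fin D.n => ((D.toEnd false ξ) ^ i.1) x)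

/-- D. **Dual `Λ* ⊆ V_n^-(E)`** of a subset `Λ` «under the hermitian form on `V_n^-(E)`» (p. 92 L26–27; p. 14 L10: `Λ*_n` «the dual
lattice of `Λ_n` under the above hermitian form»), `( , )` = ★ `herm false`: the vectors pairing `Λ` into `𝒪_E`.
[cite: Liu2021, App. A §A.1 (p. 92 L26–27); FJcycle.tex l. 4115] -/
def dualStar (Λ : Set (D.V false)) : Set (D.V false) :=
  {v | ∀ w ∈ Λ, D.herm false v w ∈ D.OE}

/-- D. **`N_i(ζ, y)`** (p. 92 L24–27), through the matching pair `(ξ, x)`: «`{𝒪_E-lattice Λ ⊆ V_n^-(E) | L ⊆ Λ ⊆ L*, ξΛ = Λ, Λ^τ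
= Λ, length_{𝒪_E}(Λ/L) = i}`, where `*` denotes dual lattice under the hermitian form on `V_n^-(E)`».
[cite: Liu2021, App. A §A.1 (p. 92 L24–27); FJcycle.tex l. 4112–4115] -/
def latticeSetN (ξ : D.U false) (x : D.V false) (i : ℕ) : Set (Submodule D.OE (D.V false)) :=
  {Λ | D.IsOELattice Λ ∧ D.latL ξ x ≤ Λ ∧ (Λ : Set (D.V false)) ⊆ D.dualStar (D.latL ξ x) ∧
    (fun v : D.V false => D.toEnd false ξ v) '' (Λ : Set (D.V false)) = Λ ∧
    D.tau ξ x '' (Λ : Set (D.V false)) = Λ ∧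
    Module.length D.OE (Λ ⧸ (D.latL ξ x).comap Λ.subtype) = i}

/-- D. **The alternating sum `Σ_{i=0}^{δ} (−1)^i (−i) · #N_i(ζ, y)`** of Prop. A.2 ∕ Lem. A.4 (p. 92 L30–31, p. 94 L7–12), for a
given upper index `δ = δ(ζ, y)` (`δ ≥ 0` in print, `= length_{𝒪_E}(L*/L)`, p. 93 L2; `Int.toNat`), `#` = ★ `Set.ncard`.
[cite: Liu2021, Prop. A.2 (p. 92 L28–31); FJcycle.tex l. 4118–4124] -/
def altSumN (ξ : D.U false) (x : D.V false) (δ : ℤ) : ℤ :=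
  ∑ i ∈ Finset.range (δ.toNat + 1), (-1 : ℤ) ^ i * (-(i : ℤ)) * ((D.latticeSetN ξ x i).ncard : ℤ)

/-! ## §5. §A.2: vertex lattices (class D) -/

/-- D. **Vertex lattice** (p. 94 L17–18): «Put `Λ := L*`.  Since `(ξ, x)` is minuscule, we know that `Λ` is a vertex lattice, namely, it
satisfies `ϖΛ ⊆ Λ* ⊆ Λ`» (on subsets of `V_n^-(E)`, `*` = `dualStar`; the remark that `L*` is one is a consequence of the
definitions, not typed as a fact). [cite: Liu2021, App. A §A.2 (p. 94 L17–18); FJcycle.tex l. 4177] -/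
def IsVertexLattice (Λ : Set (D.V false)) : Prop :=
  (fun v : D.V false => algebraMap F E D.unif • v) '' Λ ⊆ D.dualStar Λ ∧ D.dualStar Λ ⊆ Λ

end AFLCarriers

/-! ## §6. The datum `AFLData` = the objects + the printed defining sentences of the posited carriers (propositional FIELDS) -/

/-- **Standing data of App. A, II: the datum** = `AFLCarriers` + the printed DEFINING SENTENCES of its three posited
identifications, as propositional FIELDS (hypotheses every consumer sees — squad rule L5 «a faithfulness clause of a posited
carrier is a field, not a named fact»; they are definitions∕recalls in print, not results): (i) `tau_spec` — «the unique `F`-linear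
involution `τ : V_n^-(E) → V_n^-(E)` satisfying `τ(a · ξ^i x) = a^c · ξ^{-i} x` for every `a ∈ E` and `i = 0, …, n − 1`» (p. 92 L17–20;
for `(ξ, x)` regular semisimple, so that `{ξ^i x}` is a basis; `ξ^{-i}` through ★ `toEnd false ξ⁻¹`); (ii) `isMinuscule_iff` — «we
assume that `(ξ, x)` is minuscule, namely, we assume `ϖ L* ⊆ L ⊆ L*`, where `L = L_{ξ,x}`» (p. 93 L19–21 = Rem. 1.14, p. 15 L14–17),
pinning the §1.3 carpet's ⟨CARRIER⟩ ★ `Sec13Data.IsMinuscule` to the REAL condition on `latL` ∕ `dualStar` with `unif = ϖ`;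
(iii) `transferFactor_eq` — «Recall that we denote `v(ζ, y) := val(det(y₁, ζy₁, …, ζ^{n-1}y₁))`, and define the transfer factor to be
`ω(ζ, y) := (−1)^{v(ζ,y)}`» (p. 90 L19–21), identifying §1.3's `ω = μ_{E/F}(det …)` (★ `Sec13Data.transferFactor`, over the ⟨CARRIER⟩
`μ_{E/F}`) with App. A's `(−1)^v` (`omega`) on regular semisimple pairs — the bridge that chains Prop. A.2, Lem. A.4, Lem. A.6 into
★ `Sec13Data.Rem114` (Thm. A.7) as the printed proof does (p. 95 L13–14).  Nothing else is asserted.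
[cite: Liu2021, App. A §A.1 (p. 90 L19–21, p. 92 L17–20) and §A.2 (p. 93 L19–21); FJcycle.tex l. 4032, 4106, 4145–4148] -/
structure AFLData (F E : Type u) [Field F] [Field E] [Algebra F E] (κ : Type u) [Field κ] : Type (u + 1)
    extends AFLCarriers F E κ where
  /-- (i) the defining sentence of `τ` (p. 92 L17–20): additive, `F`-linear, an involution, with the displayed values. -/
  tau_spec : ∀ (ξ : U false) (x : V false), toAFLCarriers.IsRSU false ξ x →
    (∀ v w : V false, tau ξ x (v + w) = tau ξ x v + tau ξ x w) ∧
    (∀ (b : F) (v : V false), tau ξ x (algebraMap F E b • v) = algebraMap F E b • tau ξ x v) ∧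
    (∀ v : V false, tau ξ x (tau ξ x v) = v) ∧
    ∀ (a : E) (i : Fin n), tau ξ x (a • ((toEnd false ξ) ^ i.1) x) = conj a • ((toEnd false ξ⁻¹) ^ i.1) x
  /-- (ii) «minuscule» = `ϖ L* ⊆ L ⊆ L*` (p. 93 L19–21; Rem. 1.14) for the ★ carrier `IsMinuscule`. -/
  isMinuscule_iff : ∀ (ξ : U false) (x : V false), toAFLCarriers.IsRSU false ξ x →
    (IsMinuscule ξ x ↔
      (fun v : V false => algebraMap F E unif • v) '' toAFLCarriers.dualStar (toAFLCarriers.latL ξ x) ⊆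
          (toAFLCarriers.latL ξ x : Set (V false)) ∧
        (toAFLCarriers.latL ξ x : Set (V false)) ⊆ toAFLCarriers.dualStar (toAFLCarriers.latL ξ x))
  /-- (iii) §1.3's transfer factor ★ `transferFactor` equals App. A's `(−1)^{v(ζ,y)}` on regular semisimple pairs (p. 90 L19–21). -/
  transferFactor_eq : ∀ (ζ : Matrix (Fin n) (Fin n) E) (y : toAFLCarriers.Mn), ζ ∈ toAFLCarriers.Sn →
    toAFLCarriers.IsRS ζ y → toAFLCarriers.transferFactor ζ y = (toAFLCarriers.omega ζ y : ℂ)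

namespace AFLData

variable {F E : Type u} [Field F] [Field E] [Algebra F E] {κ : Type u} [Field κ] [DecidableEq κ]
variable (D : AFLData F E κ)

/-! ## §7. Lemma A.1, Proposition A.2 (class P); Remark A.3 = INDEX only -/

/-- P. **Lemma A.1**, AS PRINTED (under `NotationAsAbove`, p. 90 L14–18): «We have `d/ds|_{s=0} Orb(s; 1_{S_n(𝒪_F)}, 1_{M_n(𝒪_F)};
ζ, y) = −2 log q · ω(ζ, y) Σ_{i≥0} (−1)^i (v(ζ, y) − i) · #M_i(ζ, y)`.»  The left side is ★ `deriv` at `0` of `s ↦` ★ `orb s oneS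
oneM ζ y` (as in ★ `Sec13Data.Item112AsPrinted`); `Σ_{i≥0}` = ★ `finsum` over `ℕ` (finitely many `M_i` are non-empty, proof p. 91); `#`
= ★ `Set.ncard`; `ω` = App. A's `(−1)^{v}` (`omega`).  Proof in print: the bijection `g ↦ Λ(g) := g Mat_{n,1}(𝒪_E)` (pp. 91–92).
Nothing is asserted. [cite: Liu2021, Lem. A.1 (p. 91 L3–6); FJcycle.tex l. 4050–4055] -/
def LemA1 : Prop :=
  ∀ (ζ : Matrix (Fin D.n) (Fin D.n) E) (y : D.Mn) (ξ : D.U false) (x : D.V false), D.NotationAsAbove ζ y ξ x →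
    deriv (fun s : ℂ => D.orb s D.oneS D.oneM ζ y) 0 =
      -2 * (Real.log D.q : ℂ) * (D.omega ζ y : ℂ) *
        ∑ᶠ i : ℕ, (-1 : ℂ) ^ i * ((D.vVal ζ y : ℂ) - i) * ((D.latticeSetM ζ y i).ncard : ℂ)

/-- P. **Proposition A.2**, AS PRINTED (under `NotationAsAbove`): «We have `d/ds|_{s=0} Orb(s; 1_{S_n(𝒪_F)}, 1_{M_n(𝒪_F)}; ζ, y) =
−2 log q · ω(ζ, y) Σ_{i=0}^{δ(ζ,y)} (−1)^i (−i) · #N_i(ζ, y)`.»  Proof in print: `φ₁`, `φ₂` identify `M_i` with `N_i`, `Λ ↦ Λ*`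
swaps `N_i` and `N_{δ−i}`, `δ` odd (p. 93 L1–14).  Rem. A.3 (p. 93 L16–17): «There seems to be a sign error in [RTZ13, Corollary
7.3(2)], which is corrected in the more general Proposition A.2» — INDEX only.  Nothing is asserted.
[cite: Liu2021, Prop. A.2 (p. 92 L28–31); FJcycle.tex l. 4118–4124] -/
def PropA2 : Prop :=
  ∀ (ζ : Matrix (Fin D.n) (Fin D.n) E) (y : D.Mn) (ξ : D.U false) (x : D.V false), D.NotationAsAbove ζ y ξ x →
    deriv (fun s : ℂ => D.orb s D.oneS D.oneM ζ y) 0 =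
      -2 * (Real.log D.q : ℂ) * (D.omega ζ y : ℂ) * (D.altSumN ξ x (D.deltaVal ζ y) : ℂ)

/-! ## §8. §A.2: Lemma A.4 – Lemma A.6 (class P); Thm. A.7 = ★ `Sec13Data.Rem114` -/

/-- P. **Lemma A.4**, AS PRINTED (under `NotationAsAbove` with `(ξ, x)` minuscule (★ `IsMinuscule`, pinned by the field
`isMinuscule_iff`); `P(T)` = `redCharpoly ξ x`; `c` on `κ_E` = `conjκ`, which IS the involution induced by `c` — a standing meaning
of the carrier): «If `P(T)` has a unique self-reciprocal monic irreducible factor `Q(T)` such that `m(Q(T))` is odd, then `Σ_{i=0}^{δ(ζ,y)} (−1)^i (−i) · #N_i(ζ, y) = deg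
Q(T) · (m(Q(T))+1)/2 · ∏_{{R(T),R*(T)} ∈ NSR} (1 + m(R(T)))`.  Otherwise, we have `Σ_{i=0}^{δ(ζ,y)} (−1)^i (−i) · #N_i(ζ, y) = 0`.»
Reading of the hypothesis: `oddSelfRecFactors` is a singleton `{Q}`.  Proof in print: «the same proof as [RTZ13, Proposition
8.2]».  Nothing is asserted. [cite: Liu2021, Lem. A.4 (p. 94 L5–12); FJcycle.tex l. 4161–4170] -/
def LemA4 : Prop :=
  ∀ (ζ : Matrix (Fin D.n) (Fin D.n) E) (y : D.Mn) (ξ : D.U false) (x : D.V false),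
    D.NotationAsAbove ζ y ξ x → D.IsMinuscule ξ x →
    (∀ Q : κ[X], oddSelfRecFactors D.conjκ (D.redCharpoly ξ x) = {Q} →
        D.altSumN ξ x (D.deltaVal ζ y) = (lzCount D.conjκ (D.redCharpoly ξ x) Q : ℤ)) ∧
    ((¬ ∃ Q : κ[X], oddSelfRecFactors D.conjκ (D.redCharpoly ξ x) = {Q}) → D.altSumN ξ x (D.deltaVal ζ y) = 0)

/-- P. **Lemma A.5**, AS PRINTED (under `NotationAsAbove` with `(ξ, x)` minuscule; `Λ := L*`; `𝒱(Λ)` the Deligne–Lusztig variety of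
[LZ17, §2.5], [RTZ13, §3]): «We have a canonical isomorphism `Γ_ξ ∩ Δ𝒵_n(x) ≅ 𝒱(Λ)^{ξ̄}` of `k`-schemes.»  Proof in print: `Γ_ξ ∩
Δ𝒵_n(x) ≅ 𝒵_n(x) ∩ 𝒩_n^ξ ≅ 𝒩_Λ^ξ`, `𝒩_Λ ≅ 𝒱(Λ)` by [LZ17, Cor. 3.2.3 & §2.6].  Nothing is asserted.
[cite: Liu2021, Lem. A.5 (p. 94 L22–24); FJcycle.tex l. 4179–4185] -/
def LemA5 : Prop :=
  ∀ (ζ : Matrix (Fin D.n) (Fin D.n) E) (y : D.Mn) (ξ : D.U false) (x : D.V false),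
    D.NotationAsAbove ζ y ξ x → D.IsMinuscule ξ x → D.IsoK (D.interGammaDeltaZ ξ x) (D.dlFixed ξ x)

/-- P. **Lemma A.6**, AS PRINTED (same notation; `χ(𝒪_{Γ_ξ} ⊗^𝕃_{𝒪_{𝒩_n²}} 𝒪_{Δ𝒵_n(x)})` = ★ `chiInt ξ x`): «We have that `𝒱(Λ)^{ξ̄}` is
empty unless `P(T)` has a unique self-reciprocal monic irreducible factor `Q(T)` such that `m(Q(T))` is odd.  Assume that
`𝒱(Λ)^{ξ̄}` is non-empty.  Then `𝒱(Λ)^{ξ̄}` is an Artinian `k`-scheme, and `χ(𝒪_{Γ_ξ} ⊗^𝕃_{𝒪_{𝒩_n²}} 𝒪_{Δ𝒵_n(x)}) = length_k 𝒱(Λ)^{ξ̄} =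
deg Q(T) · (m(Q(T))+1)/2 · ∏_{{R(T),R*(T)} ∈ NSR} (1 + m(R(T)))`.»  Proof in print: Lem. A.5, [LZ17, Cor. 3.2.3], [RTZ13, Prop. 8.1],
[HLZ19, Lem. 5.1.1 & Thm. 4.6.3] («these references assume `F = ℚ_p`, but the same proof works for general `F` … [Cho]»).
Nothing is asserted. [cite: Liu2021, Lem. A.6 (p. 95 L1–7); FJcycle.tex l. 4196–4201] -/
def LemA6 : Prop :=
  ∀ (ζ : Matrix (Fin D.n) (Fin D.n) E) (y : D.Mn) (ξ : D.U false) (x : D.V false),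
    D.NotationAsAbove ζ y ξ x → D.IsMinuscule ξ x →
    ((¬ ∃ Q : κ[X], oddSelfRecFactors D.conjκ (D.redCharpoly ξ x) = {Q}) → D.IsEmptyK (D.dlFixed ξ x)) ∧
    (¬ D.IsEmptyK (D.dlFixed ξ x) →
      D.IsArtinianK (D.dlFixed ξ x) ∧
      D.chiInt ξ x = D.lengthK (D.dlFixed ξ x) ∧
      ∀ Q : κ[X], oddSelfRecFactors D.conjκ (D.redCharpoly ξ x) = {Q} →
        D.lengthK (D.dlFixed ξ x) = lzCount D.conjκ (D.redCharpoly ξ x) Q)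

-- **Theorem A.7** («1.12 holds when `(ξ, x)` is minuscule», p. 95 L12–14; proof: Prop. A.2 + Lem. A.4 + Lem. A.6) is
-- ★ `Sec13Data.Rem114` (typed with Rem. 1.14 in the §1.3 carpet): for `D : AFLData F E κ` it reads `D.Rem114` — CITED, not restated.

end AFLData

end Literature.NumberTheory.Automorphic.Liu2021.AppendixA.AFLMinusculeCase

end
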